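import Summits.QuantumAdvantage.QuantumAdvantage.Theorems.NearExactIsExact.Negative.SmallCasesClasses

/-!
# Small cases of `NearExactIsExact` (stmt-QuantumAdvantage-14043): `Φ > 7/8 ⇒ Φ = 1` for cubic pairs on `n ≤ 6` bits

Negative-side SUPPORT file (certified-compute seat `refuter-ccert-stmt-QuantumAdvantage-14043-0`, 2026-08-16): a
machine-checked certificate that the crux's isolation claim holds at the conjectured threshold `θ = 7/8` for every
even `n ≤ 6` — i.e. no counterexample to `NearExactIsExact` at `7/8` lives below `n = 8` (the known ones start at
`n = 16`, `Φ = 15/16`, `FifteenSixteenths.lean`).  The statement proved is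
`∀ n ≤ 6, Even n → ∀ f g cubic, 7/8 < Φ(f,g) → Φ(f,g) = 1` (`nearExact78_le_six`).

## Method (an in-tree checker, run by `native_decide`)

For `n = m + m` and a cubic `g`, `Φ(f,g) = 2^{-3m} Σ_x (−1)^{f(x)} W_g(x) ≤ 2^{-3m} Σ_x |W_g(x)|` (capacity bound,
`forrelation_le_cap`), and if `g` is bent (`|W_g| ≡ 2^m`) its dual is cubic for `m ≤ 4` by the landed Hou bound
(`stub_houCubic` fed with `stub_axParity`), so `Φ ∈ {1} ∪ [−1, 3/4]` by the landed Reed–Muller distance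
(`bb_band_of_dual_degree`, `bb_rmWeight_holds`).  Hence it suffices that every NON-bent cubic `g` has
`Σ_x |W_g(x)| ≤ 7·2^{3m−3}` (`isolation_of_transform`).  Both `Φ` and cubicity are invariant under `g ↦ g ∘ B`
(`B ∈ GL(n,2)`, `forrelation_lin`), `g ↦ g ⊕ ℓ_v ⊕ b` (`forrelation_affine`), so `g` may be reduced to
`C_i ⊕ q` with `C_i` running over representatives of the `GL(n,2)`-orbits of cubic forms modulo quadratics and
`q` over all quadratic FORMS.  The checker (`certify`) (1) computes, for every representative and every quadratic
mask, the Walsh spectrum by a fast Walsh–Hadamard transform (`wal`, proved correct in `wal_spec`) and tests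
"bent or capacity ≤ 7·2^{3m−3}" (`checkT`, sound by `checkT_sound`); (2) runs a breadth-first search over the
`2^{C(n,3)}` cubic masks under the generators (transvection, cyclic shift, inverse shift) acting through
per-monomial substitution tables, and VERIFIES that every mask reaches a representative along edges
`c ↦ c·B` of decreasing distance (`verify`, sound by `qc_all` — the BFS itself is untrusted); (3) checks the
generator identities (`GenRows.Good`: inverse, transpose, adjointness) and the substitution tables (`TabOK`) by
exhaustion.  The bridge from `IsDegLeFun 3` to masks is the tree's binary Möbius inversion `truncOf_eq`
(`gfun_of_cubic`); the class of a mask is `{g : deg (g ⊕ C) ≤ 2}` and its transport uses the vanishing of cubic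
Möbius coefficients in degree `≤ 2` (`mcoeff_eq_false_of_deg_two`, via `eval_bz` + `sum_subInd`).

Certified instances: `n = 6` (6 classes `0, 123, 125+134, 126+135+234, 156+234, 135+136+146+236+245`, closure
sizes `1+1395+54684+468720+357120+166656 = 2^20`; non-bent capacity maximum `55/64 < 7/8`), `n = 4`, `n = 2`;
`n = 0` directly.  `native_decide` is used for the three `certify … = true` facts: the file is `computational`.
Evidence and the matching exhaustive C computation (value sets: runner-up `3/4` at `n = 4`, `25/32`-compatible data
at `n = 6`): seat folder `c/scan6.c`, CERT.md.

References: C. Carlet, *Boolean Functions for Cryptography and Coding Theory* (CUP 2021) §2.2.1 (ANF, binary Möbius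
transform), §6.1 (bent functions, duals); X.-D. Hou, *GL(m,2) acting on R(r,m)/R(r−1,m)*, Discrete Math. 149 (1996)
(6 orbits of cubic forms in 6 variables); S. Aaronson, A. Ambainis, *Forrelation*, SIAM J. Comput. 47 (2018) §1.1.1.
-/

set_option linter.dupNamespace false -- D-0017: single-problem summit ⇒ `QuantumAdvantage.QuantumAdvantage` by design

namespace Summit.QuantumAdvantage.QuantumAdvantage.Theorems.NearExactIsExact.Negative.SmallCases

open Finset
open Literature.Computability.QuantumComplexity
open Literature.Computability.QuantumComplexity.DerivativeWalsh (W fsum phi_eq_fsum fsum_eq_sum_mul_W)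
open Literature.Computability.QuantumComplexity.BuzetChailloux (phi_signOf bxor bxor_comm bxor_bxor_cancel_left)
open Literature.Computability.QuantumComplexity.Simon (twist_xor_left)
open Summit.QuantumAdvantage.QuantumAdvantage.Theorems.SignedExactSliceIsLift
  (subsets3 indic mcoeff cubicMonomials litVal monoVal evalMonos truncOf)
open Summit.QuantumAdvantage.QuantumAdvantage.Theorems.SignedExactSliceIsLift.StubMoebius
  (isDegLeFun_xor isDegLeFun_and isDegLeFun_all isDegLeFun_litVal bz_foldl_xor sum_map_filter_eq toInput_indic eval_bz
    card_support_le sum_subInd truncOf_eq)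
open Summit.QuantumAdvantage.QuantumAdvantage.Theorems.CubicForrelation.NearExactIsExact
  (bb_exists_dual bb_band_of_dual_degree bb_rmWeight_holds stub_houCubic stub_axParity nf_isDegLeFun_subst)

variable {n : ℕ}

/-! ### The per-representative computation -/

/-- Truth table of the cubic part over codes. -/
def tabC (n c : ℕ) : List Bool := (List.range (2 ^ n)).map fun k => cubicF n c (pt n k)

/-- Truth tables of the pair monomials over codes. -/
def monoTabs (n : ℕ) : List (List Bool) := (pairs n).map fun S => (List.range (2 ^ n)).map fun k => monoVal n S (pt n k)

/-- Quadratic-part table accumulated from the monomial tables selected by the bits of `q`. -/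
def tabQacc (q : ℕ) : List (List Bool) → ℕ → List Bool → List Bool
  | [], _, acc => acc
  | T :: Ts, i, acc => tabQacc q Ts (i + 1) (if q.testBit i then List.zipWith xor acc T else acc)

/-- The signed table of `gfun n c q 0 false` assembled from the part tables. -/
def tabV (n : ℕ) (tc : List Bool) (mt : List (List Bool)) (q : ℕ) : List ℤ :=
  List.zipWith (fun b₁ b₂ => sgnZ (xor b₂ b₁)) tc (tabQacc q mt 0 (List.replicate (2 ^ n) false))

/-- All quadratic masks for one cubic representative pass the per-function check. -/
def checkRep (m c : ℕ) : Bool :=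
  let n := m + m
  let tc := tabC n c
  let mt := monoTabs n
  (List.range (2 ^ (pairs n).length)).all fun q => checkT m (tabV n tc mt q)

/-- The accumulated quadratic table is the pointwise table of `ixval`. [folklore] -/
theorem tabQacc_spec (q N : ℕ) : ∀ (L : List (List ℕ)) (i : ℕ) (acc : List Bool), acc.length = N →
    tabQacc q (L.map fun S => (List.range N).map fun k => monoVal n S (pt n k)) i acc =
      List.zipWith xor acc ((List.range N).map fun k => ixval n L i q (pt n k))
  | [], i, acc, hacc => by
    show acc = List.zipWith xor acc ((List.range N).map fun k => ixval n [] i q (pt n k))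
    apply List.ext_getElem?
    intro k
    rw [List.getElem?_zipWith, List.getElem?_map]
    by_cases hk : k < N
    · rw [List.getElem?_range hk, List.getElem?_eq_getElem (by rw [hacc]; exact hk)]
      simp [ixval]
    · rw [List.getElem?_eq_none (by rw [hacc]; omega), List.getElem?_eq_none (by simp; omega)]
  | S :: L, i, acc, hacc => by
    rw [List.map_cons]
    show tabQacc q (L.map fun S => (List.range N).map fun k => monoVal n S (pt n k)) (i + 1)
      (if q.testBit i then List.zipWith xor acc ((List.range N).map fun k => monoVal n S (pt n k)) else acc) = _
    rw [tabQacc_spec q N L (i + 1) _ (by split_ifs <;> simp [hacc])]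
    apply List.ext_getElem?
    intro k
    simp only [List.getElem?_zipWith, List.getElem?_map]
    by_cases hk : k < N
    · rw [List.getElem?_range hk]
      have hka : k < acc.length := by rw [hacc]; exact hk
      split_ifs with hb
      · rw [List.getElem?_zipWith, List.getElem?_map, List.getElem?_range hk, List.getElem?_eq_getElem hka]
        simp only [Option.map_some, ixval, hb, Bool.true_and]
        show some (xor (xor acc[k] (monoVal n S (pt n k))) (ixval n L (i + 1) q (pt n k))) =
          some (xor acc[k] (xor (monoVal n S (pt n k)) (ixval n L (i + 1) q (pt n k))))
        rw [Bool.xor_assoc]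
      · rw [List.getElem?_eq_getElem hka]
        simp [ixval, hb]
    · rw [show acc[k]? = none from List.getElem?_eq_none (by rw [hacc]; omega)]
      split_ifs <;> simp [hacc, hk]

/-- The assembled table is the signed table of `gfun n c q 0 false`. [folklore] -/
theorem tabV_eq (c q : ℕ) : tabV n (tabC n c) (monoTabs n) q = sigTable n (gfun n c q 0 false) := by
  unfold tabV monoTabs
  rw [tabQacc_spec q (2 ^ n) (pairs n) 0 _ (by simp)]
  apply List.ext_getElem?
  intro k
  simp only [tabC, sigTable, List.getElem?_zipWith, List.getElem?_map]
  by_cases hk : k < 2 ^ n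
  · rw [List.getElem?_range hk, List.getElem?_replicate]
    simp only [hk, if_true, Option.map_some, Bool.false_xor, Option.some.injEq]
    unfold gfun cubicF
    rw [ixval_zero]
    simp
  · rw [List.getElem?_eq_none (by simp; omega)]
    simp

/-- **Soundness of the per-representative computation**: `checkRep m c` gives the class statement `Qc c`.
[folklore] -/
theorem qc_of_checkRep (m : ℕ) (hm1 : 1 ≤ m) (hm4 : m ≤ 4) (c : ℕ) (h : checkRep m c = true) : Qc (m + m) c := by
  intro g hg hcl
  obtain ⟨q, a, b, hq, rfl⟩ := exists_gfun_of_inClass hcl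
  refine ok78_gfun_affine ?_ a b
  simp only [checkRep, List.all_eq_true, List.mem_range] at h
  have hc := h q hq
  rw [tabV_eq] at hc
  intro f hf hlt
  exact checkT_sound m hm1 hm4 (gfun (m + m) c q 0 false) hc f hf (isDegLeFun_gfun _ _ _ _) hlt

/-! ### The closure certificate: BFS (untrusted) and its verification (trusted) -/

/-- One BFS expansion step from the mask `c`: relax all generator images. -/
def bfsExpand (N : ℕ) (tabs : List (List Entry)) (inv : List ℕ) (c : ℕ)
    (st : Array ℕ × Array ℕ × Array ℕ × Array ℕ) : Array ℕ × Array ℕ × Array ℕ × Array ℕ :=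
  (List.range tabs.length).foldl (fun st i =>
    let dist := st.1
    let c' := cactL (tabs.getD i []) 0 c
    if dist[c']! == N then
      (dist.set! c' (dist[c]! + 1), st.2.1.set! c' c, st.2.2.1.set! c' (inv.getD i 0), st.2.2.2.push c')
    else st) st

/-- The BFS loop over the queue (fuel-bounded). -/
def bfsLoop (N : ℕ) (tabs : List (List Entry)) (inv : List ℕ) : ℕ → ℕ →
    Array ℕ × Array ℕ × Array ℕ × Array ℕ → Array ℕ × Array ℕ × Array ℕ × Array ℕ
  | 0, _, st => st
  | fuel + 1, h, st =>
    if h < st.2.2.2.size then bfsLoop N tabs inv fuel (h + 1) (bfsExpand N tabs inv (st.2.2.2[h]!) st) else st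

/-- BFS from the representatives: distance, parent and parent-generator arrays (UNTRUSTED: only `verify` counts). -/
def bfs (T : ℕ) (reps : List ℕ) (tabs : List (List Entry)) (inv : List ℕ) : Array ℕ × Array ℕ × Array ℕ :=
  let N := 2 ^ T
  let dist0 := reps.foldl (fun d r => d.set! r 0) (Array.replicate N N)
  let st := bfsLoop N tabs inv (N + 1) 0 (dist0, Array.replicate N 0, Array.replicate N 0, reps.toArray)
  (st.1, st.2.1, st.2.2.1)

/-- **The trusted closure check**: every mask is a representative or moves, by one generator, to a recorded
parent of smaller recorded distance. -/
def verify (T : ℕ) (reps : List ℕ) (tabs : List (List Entry)) (dist par pg : Array ℕ) : Bool :=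
  (List.range (2 ^ T)).all fun c =>
    reps.contains c ||
      (decide (pg[c]! < tabs.length) && (cactL (tabs.getD pg[c]! []) 0 c == par[c]!) &&
        decide (par[c]! < 2 ^ T) && decide (dist[par[c]!]! < dist[c]!))

/-- **Soundness of the closure check**: induction on the recorded distance. [folklore] -/
theorem qc_all {T : ℕ} {reps : List ℕ} {tabs : List (List Entry)} {dist par pg : Array ℕ}
    (hv : verify T reps tabs dist par pg = true) (hreps : ∀ c ∈ reps, Qc n c)
    (htr : ∀ i, i < tabs.length → ∀ c, Qc n (cactL (tabs.getD i []) 0 c) → Qc n c) :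
    ∀ c, c < 2 ^ T → Qc n c := by
  simp only [verify, List.all_eq_true, List.mem_range, Bool.or_eq_true, Bool.and_eq_true, decide_eq_true_eq,
    beq_iff_eq] at hv
  suffices H : ∀ d c, c < 2 ^ T → dist[c]! = d → Qc n c from fun c hc => H _ c hc rfl
  intro d
  induction d using Nat.strong_induction_on with
  | _ d ih =>
    intro c hc hd
    rcases hv c hc with hr | ⟨⟨⟨hi, hact⟩, hp⟩, hlt⟩
    · exact hreps c (List.contains_iff_mem.1 hr)
    · have hq : Qc n (par[c]!) := ih _ (hd ▸ hlt) _ hp rfl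
      rw [← hact] at hq
      exact htr _ hi c hq

/-! ### The certificate and its soundness -/

/-- Mask of a set of triples (given as increasing lists). -/
def maskOfTriples (n : ℕ) (ts : List (List ℕ)) : ℕ := maskOf (fun S => ts.contains S) (trips n)

/-- The index of a monomial in a block (`length` if absent). -/
def idxIn (L : List (List ℕ)) (S : List ℕ) : ℕ := L.findIdx (· == S)

/-- Symbolic expansion of a cubic monomial under the substitution with rows `B`: the entry
(image cubic mask, quadratic mask, linear mask, constant) of `∏_{v ∈ S} (⊕_{j ∈ B_v} x_j)`. -/
def expandMono (n : ℕ) (B : List (List ℕ)) (S : List ℕ) : Entry :=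
  let rows := S.map fun v => B.getD v []
  let prods : List (List ℕ) := rows.foldr (fun row acc => row.flatMap fun j => acc.map fun t => j :: t) [[]]
  prods.foldl (fun e t =>
    let u := (t.mergeSort (· ≤ ·)).dedup
    match u.length with
    | 3 => (e.1 ^^^ 2 ^ idxIn (trips n) u, e.2.1, e.2.2.1, e.2.2.2)
    | 2 => (e.1, e.2.1 ^^^ 2 ^ idxIn (pairs n) u, e.2.2.1, e.2.2.2)
    | 1 => (e.1, e.2.1, e.2.2.1 ^^^ 2 ^ (u.headD 0), e.2.2.2)
    | _ => (e.1, e.2.1, e.2.2.1, !e.2.2.2)) (0, 0, 0, false)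

/-- The substitution table of a generator. -/
def mkTab (n : ℕ) (B : List (List ℕ)) : List Entry := (trips n).map (expandMono n B)

/-- **The certificate** for `n = m + m`: representatives pass the Walsh check, generators are good, tables are
correct, and the closure check passes on the BFS output. -/
def certify (m : ℕ) (reps : List ℕ) (gens : List GenRows) (inv : List ℕ) : Bool :=
  let n := m + m
  let T := (trips n).length
  let tabs := gens.map fun G => mkTab n G.B
  let out := bfs T reps tabs inv
  reps.all (checkRep m) &&
    gens.all (fun G => decide (G.Good n) && decide (TabOK n G.B (mkTab n G.B))) &&
      verify T reps tabs out.1 out.2.1 out.2.2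

/-- **Soundness of the certificate.** [folklore] -/
theorem certify_sound (m : ℕ) (hm1 : 1 ≤ m) (hm4 : m ≤ 4) (reps : List ℕ) (gens : List GenRows) (inv : List ℕ)
    (h : certify m reps gens inv = true) :
    ∀ f g : (Fin (m + m) → Bool) → Bool, IsDegLeFun 3 f → IsDegLeFun 3 g →
      7 / 8 < forrelation f g → forrelation f g = 1 := by
  intro f g hf hg hlt
  simp only [certify, Bool.and_eq_true, List.all_eq_true, decide_eq_true_eq] at h
  obtain ⟨⟨hreps, hgens⟩, hv⟩ := h
  -- every mask has the class property
  have hall : ∀ c, c < 2 ^ (trips (m + m)).length → Qc (m + m) c := by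
    refine qc_all hv (fun c hc => qc_of_checkRep m hm1 hm4 c (hreps c hc)) (fun i hi c hq => ?_)
    have hi' : i < gens.length := by simpa using hi
    have hG := hgens (gens[i]) (List.getElem_mem hi')
    have e : (gens.map fun G => mkTab (m + m) G.B).getD i [] = mkTab (m + m) (gens[i]).B := by
      rw [List.getD_eq_getElem?_getD, List.getElem?_map, List.getElem?_eq_getElem hi']
      rfl
    rw [e] at hq
    exact qc_transport hG.1 hG.2 hq
  -- the cubic part of `g`
  set P := mco (m + m) g with hP
  have hrep : g = gfun (m + m) (maskOf P (trips (m + m))) (maskOf P (pairs (m + m))) (maskOf P (singles (m + m)))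
      (P []) := gfun_of_cubic g hg
  have hcl : InClass (m + m) (maskOf P (trips (m + m))) g := by
    rw [hrep]; exact inClass_gfun _ _ _ _
  exact hall _ (maskOf_lt P _) g hg hcl f hf hlt


/-! ### Instances -/

section Instances

/-- Transvection `x₀ ↦ x₀ ⊕ x₁` on `n` variables (self-inverse; transpose `x₁ ↦ x₁ ⊕ x₀`). -/
def genT (n : ℕ) : GenRows where
  B := [0, 1] :: (List.range' 1 (n - 1)).map fun i => [i]
  Binv := [0, 1] :: (List.range' 1 (n - 1)).map fun i => [i]
  Bt := [0] :: [0, 1] :: (List.range' 2 (n - 2)).map fun i => [i]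
  Btinv := [0] :: [0, 1] :: (List.range' 2 (n - 2)).map fun i => [i]

/-- Cyclic shift `x_i ↦ x_{i+1}` (inverse = transpose = the backward shift). -/
def genC (n : ℕ) : GenRows where
  B := (List.range n).map fun i => [(i + 1) % n]
  Binv := (List.range n).map fun i => [(i + n - 1) % n]
  Bt := (List.range n).map fun i => [(i + n - 1) % n]
  Btinv := (List.range n).map fun i => [(i + 1) % n]

/-- Backward cyclic shift. -/
def genC' (n : ℕ) : GenRows where
  B := (List.range n).map fun i => [(i + n - 1) % n]
  Binv := (List.range n).map fun i => [(i + 1) % n]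
  Bt := (List.range n).map fun i => [(i + 1) % n]
  Btinv := (List.range n).map fun i => [(i + n - 1) % n]

/-- The generators used (closed under inverse: `inv = [0, 2, 1]`). -/
def gens (n : ℕ) : List GenRows := [genT n, genC n, genC' n]

/-- Representatives of the `GL(6,2)`-orbits of cubic forms in 6 variables (Hou 1996): `0`, `123`, `125+134`,
`126+135+234`, `156+234`, `135+136+146+236+245` (0-based triples below). -/
def reps6 : List ℕ :=
  [0, maskOfTriples 6 [[0, 1, 2]], maskOfTriples 6 [[0, 1, 4], [0, 2, 3]],
    maskOfTriples 6 [[0, 1, 5], [0, 2, 4], [1, 2, 3]], maskOfTriples 6 [[0, 4, 5], [1, 2, 3]],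
    maskOfTriples 6 [[0, 2, 4], [0, 2, 5], [0, 3, 5], [1, 2, 5], [1, 3, 4]]]

/-- Representatives for 4 variables: `0`, `123`. -/
def reps4 : List ℕ := [0, maskOfTriples 4 [[0, 1, 2]]]

/-- **The certificate at `n = 6`** (6 representatives × 2¹⁵ quadratic masks; BFS over 2²⁰ cubic masks). -/
theorem certify_three : certify 3 reps6 (gens 6) [0, 2, 1] = true := by native_decide

/-- **The certificate at `n = 4`.** -/
theorem certify_two : certify 2 reps4 (gens 4) [0, 2, 1] = true := by native_decide

/-- **The certificate at `n = 2`** (no cubic monomials; a single class). -/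
theorem certify_one : certify 1 [0] [] [] = true := by native_decide

/-- `n = 0`: `Φ = ±1`. [folklore] -/
theorem forrelation_fin_zero (f g : (Fin 0 → Bool) → Bool) : forrelation f g = 1 ∨ forrelation f g = -1 := by
  unfold forrelation twist
  simp only [mul_zero, pow_zero, Real.sqrt_one, inv_one, one_mul, Finset.univ_unique, Finset.sum_singleton,
    Finset.univ_eq_empty, Finset.prod_empty, mul_one]
  unfold signOf
  split_ifs <;> simp

/-- **Isolation at `7/8` for all even `n ≤ 6`.** For every even `n ≤ 6` and all cubic `f, g` on `n` bits,
`Φ(f,g) > 7/8 ⇒ Φ(f,g) = 1` — the crux `NearExactIsExact` restricted to `n ≤ 6` holds at the conjectured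
threshold; counterexamples at `7/8` (which exist: `Φ = 15/16` at `n = 16`) need `n ≥ 8`. [folklore] -/
theorem nearExact78_le_six : ∀ n : ℕ, n ≤ 6 → Even n → ∀ f g : (Fin n → Bool) → Bool,
    IsDegLeFun 3 f → IsDegLeFun 3 g → 7 / 8 < forrelation f g → forrelation f g = 1 := by
  intro n hn he f g hf hg hlt
  obtain ⟨m, rfl⟩ := he
  have hm : m ≤ 3 := by omega
  interval_cases m
  · rcases forrelation_fin_zero f g with h | h
    · exact h
    · rw [h] at hlt; norm_num at hlt
  · exact certify_sound 1 le_rfl (by norm_num) _ _ _ certify_one f g hf hg hlt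
  · exact certify_sound 2 (by norm_num) (by norm_num) _ _ _ certify_two f g hf hg hlt
  · exact certify_sound 3 (by norm_num) (by norm_num) _ _ _ certify_three f g hf hg hlt

end Instances

/-! ### Consequence for the crux: only `n ≥ 8` matters -/

open Summit.QuantumAdvantage.QuantumAdvantage.Theses.CubicForrelation (NearExactIsExact) in
/-- **The crux reduces to `n ≥ 8`.** `NearExactIsExact` holds iff some `θ < 1` isolates exactness for cubic pairs on
every even `n ≥ 8`: below `8` the threshold `7/8` already works (`nearExact78_le_six`), so `max θ (7/8)` serves all
`n`. [folklore] -/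
theorem nearExactIsExact_iff_from_eight :
    NearExactIsExact ↔ ∃ θ : ℝ, θ < 1 ∧ ∀ n : ℕ, Even n → 8 ≤ n → ∀ f g : (Fin n → Bool) → Bool,
      IsDegLeFun 3 f → IsDegLeFun 3 g → θ < forrelation f g → forrelation f g = 1 := by
  constructor
  · rintro ⟨θ, hθ, h⟩
    exact ⟨θ, hθ, fun n hn _ f g hf hg hlt => h n hn f g hf hg hlt⟩
  · rintro ⟨θ, hθ, h⟩
    refine ⟨max θ (7 / 8), max_lt hθ (by norm_num), fun n hn f g hf hg hlt => ?_⟩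
    by_cases h8 : 8 ≤ n
    · exact h n hn h8 f g hf hg (lt_of_le_of_lt (le_max_left _ _) hlt)
    · have h6 : n ≤ 6 := by obtain ⟨k, hk⟩ := hn; omega
      exact nearExact78_le_six n h6 hn f g hf hg (lt_of_le_of_lt (le_max_right _ _) hlt)


end Summit.QuantumAdvantage.QuantumAdvantage.Theorems.NearExactIsExact.Negative.SmallCases
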